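import Mathlib
import HarnessLib
import Literature.Geometry.Lorentzian.NearKerrLeaf

/-!
# Route BartnikGapSettling — crux `BondiBartnikRigidity` (stmt-FinalStateConjecture-10807),
line `Sketch`, stub `stub_trivialRegime`

The TRIVIAL REGIME of the crux: if the geometry bound of the hypothesis leaf already beats the
target tolerance (`Λ ≤ ε`) and the requested derivative count is not larger (`k ≤ k'`), then the
hypothesis leaf `S` is itself an `(ε, k)`-near-Kerr leaf (monotonicity of `IsNearKerrLeaf` in
`(k, ε)`, `CauchyDevelopment.IsNearKerrLeaf.mono`) lying in its own causal future
(`S ⊆ J⁺(S)`, `LorentzianMetric.subset_causalFuture`). This is the branch `Λ ≤ ε` of the lead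
skeleton's composition `BondiBartnikRigidity_of`; the registered stub signature is reproduced
verbatim.
-/

-- D-0017: single-problem summit, `Summit.<S>.<S>.…` by design (cf. lakefile `weak.linter.dupNamespace`).
set_option linter.dupNamespace false

namespace Summit.FinalStateConjecture.FinalStateConjecture.Theorems

open Set Literature.Geometry.Lorentzian
open scoped Manifold ContDiff Topology ENNReal

/-- **Trivial regime of `BondiBartnikRigidity`** (line `Sketch`, stub `stub_trivialRegime`): for
`k ≤ k'` and `Λ ≤ ε`, every `(Λ, k')`-near-Kerr leaf `S` of a vacuum Cauchy development (with `N`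
holes of masses `M` and spins `a`) admits an `(ε, k)`-near-Kerr leaf with the same `(N, M, a)` in
`J⁺(S)` — namely `S` itself (`IsNearKerrLeaf.mono` and `S ⊆ J⁺(S)`). -/
theorem stub_trivialRegime : ∀ (k k' : ℕ) (ε Λ : ℝ≥0∞), k ≤ k' → Λ ≤ ε →
    ∀ (X : Type) [TopologicalSpace X] [ChartedSpace E3 X] [IsManifold (𝓡 3) ∞ X]
      [T2Space X] [SecondCountableTopology X] [ConnectedSpace X]
      (D : InitialDataSet (𝓡 3) X) (𝒟 : VacuumCauchyDevelopment D) (N : ℕ) (M a : Fin N → ℝ)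
      (S : Set 𝒟.carrier), 𝒟.toCauchyDevelopment.IsNearKerrLeaf k' Λ N M a S →
      ∃ S' : Set 𝒟.carrier, 𝒟.toCauchyDevelopment.IsNearKerrLeaf k ε N M a S' ∧
        S' ⊆ 𝒟.metric.causalFuture 𝒟.timeOrientation S := by
  intro k k' ε Λ hk hΛ X _ _ _ _ _ _ D 𝒟 N M a S hS
  exact ⟨S, hS.mono hk hΛ, LorentzianMetric.subset_causalFuture _ _ S⟩

end Summit.FinalStateConjecture.FinalStateConjecture.Theorems
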